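import Summits.BirchSwinnertonDyer.BirchSwinnertonDyer.Theorems.SmallImageMuTransferMuTransferX9StepFourReciprocityTwist
import HarnessLib

/-!
# K6 crux `MuTransferX9` (stmt-BirchSwinnertonDyer-19276), MU-TRANSFER-PROOF §5 STEP 4: the SEAMS
# between the global statement (x10's `…X9StepFourReciprocity{,Twist}`) and the local currencies of the
# other hands — `T^ε · H¹(K_v, 𝒯_J) = 0` on `S` (G1-LOCAL, `bsd-smallim-k6-g4`), the local cup product
# at `q` (the `q`-term, `bsd-smallim-koly` g8), the local shift

Cell `b2b-bsdres`, unit `b2b-bsdres-x10` (N2 = X10b at `p = 3` class lead, GEN 38; G4 = STEP 4 of the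
assembler's cut of `stub_coreX9`, crux 19276, cell `bsd-smallim`, skeleton v4 sha16 0154dd5daf38efd6 →
v5). HONEST FRAMING: TOOL theorems; no definition, no named fact, no `sorry`; nothing is asserted about any
curve, nothing is booked; X9 stays TYPED at class level, X10b (N2) keeps its label CONSTRUCTION-SHAPED /
NEEDS X_A3. `--supports stmt-BirchSwinnertonDyer-19276` (helper; closes nothing). PARTITION (D-0054): X9
(A4) × `p ∈ {5, 7}` · X10b (A5) × `p = 3` (prime-generic, `p` odd).

## Content (number field `K`, `κ : ZpExtension K p`, twists `𝒯_J = κ.twistModP ρ hM J`)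

* §1 **Localisation commutes with (iterates of) the shift**: `loc_v (T^k x) = T_v^k (loc_v x)` where
  `T_v = H¹((twistModPShift)|_{Γ_{K_v}})` (`localization_iterate_map`, `localization_iterate_shiftH1`);
  hence **`loc_v (T^ε ψ) = 0` as soon as `T_v^ε` kills `H¹(K_v, 𝒯_J|_v)`**
  (`localization_iterate_shiftH1_eq_zero_of_forall`) — the seam to the UNIFORM LOCAL EXPONENT of the
  Selmer side (G1 design note of `bsd-smallim-k6-c2` g3, STATUS 12:12Z; G1-LOCAL `…X9LocalExponentBadPrimes`).
* §2 **STEP 4 in the Selmer side's currency** (`localTerm_iterate_shiftH1_eq_zero_of_localExponent`):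
  `x ∈ H¹(K, 𝒯_J(ρ, κ))` unramified off `S ∪ {q}` (the Kolyvagin class of G3), `ψ ∈ H¹(K, 𝒯_J(ρ′, κ⁻¹))`
  unramified off `S ∪ {q}` (the Selmer-side class of G1), `T_v^ε · H¹(K_v, 𝒯_J(ρ′, κ⁻¹)) = 0` for
  `v ∈ S` (G1-LOCAL), `S ∋` every `v ∣ p` and every ramified `v ≠ q` of `ρ` ⟹ for EVERY `k` the local
  term at `q` of `(T^k x, (twistDualMap)_* (T^ε ψ))` vanishes — MU-TRANSFER-PROOF §5 STEP 4's
  «`Σ_v inv_v(T^ε κ_q ∪ y) = 0` … hence `inv_q = 0`», all coefficients at once, at every odd `p`.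
* §3 the local forms of the term at `q`: `⟨x_q, ((B^♭)_* y)_q⟩_q = inv_q(loc_q x ∪ (B^♭|_{Γ_{K_q}})_* loc_q y)`
  (`localTerm_twistDualMap_eq_localTatePairingZMod`, rfl-level) and, for the cup product of k6-ty's
  `twistContPairing`, `loc_q(x ∪ y) = loc_q x ∪ loc_q y` for the RESTRICTED pairing
  (`localization_cupProduct_twistContPairing`, tree `ContPairing.cupProduct_res`) — the currency of
  `bsd-smallim-koly`'s `q`-term identification (Lemma 1 (iii), STATUS 13:01Z), so that «every member of
  the coefficient family vanishes» can be read on local classes: `inv_q(T_q^k (loc_q x) ∪ loc_q y) = 0`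
  (`inv_cupProduct_restrict_iterate_localShift_eq_zero_of_localExponent`).

References: HOME pub/bsd-smallim/koly/MU-TRANSFER-PROOF.md §5 STEP 4, (F6), (F7); J. S. Milne,
*Arithmetic Duality Theorems* (2006), I Thm. 4.10 (b), Lemma 2.8-type local bounds (F6) [MilneADT2006];
J.-P. Serre, *Galois Cohomology* (1997), I §2.2–§2.4 (functoriality, restriction) [SerreGaloisCohomology1997];
J. Neukirch, A. Schmidt, K. Wingberg, *Cohomology of Number Fields* (2008), I §4 (1.4.2)
[NeukirchSchmidtWingberg2008].
-/

-- the summit and its single problem are both named `BirchSwinnertonDyer` (registry layout D-0017)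
set_option linter.dupNamespace false

set_option autoImplicit false

noncomputable section

open scoped ContRepresentation
open Function NumberField IsDedekindDomain Field
open scoped NumberField
open Literature.NumberTheory.GaloisRepresentations
open Literature.NumberTheory.GaloisRepresentations.DiscreteGaloisModule (mu MuCarrier pairing TateDual
  tateDual pairingDualIntertwining)
open Literature.NumberTheory.GaloisCohomology
open Literature.NumberTheory.EllipticCurves
open Summit.BirchSwinnertonDyer.Rank1Residual.GaloisImage

universe u

namespace Summit.BirchSwinnertonDyer.BirchSwinnertonDyer.Rank1Residual.StepFour

variable {K : Type u} [Field K] [NumberField K]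

/-! ### §1 Localisation commutes with iterates of an equivariant endomorphism; the shift -/

section Iterate

variable {M : Type u} [AddCommGroup M] [TopologicalSpace M] [DiscreteTopology M]
  {ρM : DiscreteGaloisModule K M}

/-- **`loc_v (φ_*^k x) = (φ|_{Γ_{K_v}})_*^k (loc_v x)`** for an equivariant endomorphism `φ` of `M`
(`localization_map_eq`, iterated). [cite: SerreGaloisCohomology1997, I §2.4] -/
theorem localization_iterate_map (φ : ρM.toContRepresentation →ⁱL ρM.toContRepresentation)
    (v : Place K) (x : galoisCohomology ρM 1) (k : ℕ) :
    galoisCohomology.localization ρM v 1 ((galoisCohomology.map φ 1)^[k] x) =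
      (galoisCohomology.map (φ.restrictField (Place.Completion v)) 1)^[k]
        (galoisCohomology.localization ρM v 1 x) := by
  induction k with
  | zero => rfl
  | succ k ih => rw [Function.iterate_succ_apply', Function.iterate_succ_apply', localization_map_eq, ih]

/-- If `(φ|_{Γ_{K_v}})_*^k` kills `H¹(K_v, M|_v)` then `loc_v (φ_*^k x) = 0` for every global `x`.
[cite: SerreGaloisCohomology1997, I §2.4] -/
theorem localization_iterate_map_eq_zero_of_forall
    (φ : ρM.toContRepresentation →ⁱL ρM.toContRepresentation) (v : Place K) (k : ℕ)
    (hφ : ∀ c : galoisCohomology (ρM.toLocal v) 1,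
      (galoisCohomology.map (φ.restrictField (Place.Completion v)) 1)^[k] c = 0)
    (x : galoisCohomology ρM 1) :
    galoisCohomology.localization ρM v 1 ((galoisCohomology.map φ 1)^[k] x) = 0 := by
  rw [localization_iterate_map]
  exact hφ _

end Iterate

section Twist

variable {p : ℕ} [Fact p.Prime] (κ : ZpExtension K p)
variable {M M' : Type u} [AddCommGroup M] [TopologicalSpace M] [DiscreteTopology M] [Finite M]
  [AddCommGroup M'] [TopologicalSpace M'] [DiscreteTopology M']
variable (ρ : DiscreteGaloisModule K M) (ρ' : DiscreteGaloisModule K M')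
  (hM : ∀ x : M, p • x = 0) (hM' : ∀ x : M', p • x = 0) (J : ℕ)

omit [Finite M] in
/-- **`loc_v (T^k x) = T_v^k (loc_v x)`** for the shift `T` on `H¹(K, 𝒯_J)` (`shiftH1 = H¹(twistModPShift)`)
and its local counterpart `T_v = H¹(twistModPShift|_{Γ_{K_v}})` at a FINITE place `v`, in the
`GaloisRep.toLocal v` currency of the local files. [cite: SerreGaloisCohomology1997, I §2.4] -/
theorem localization_iterate_shiftH1 (v : HeightOneSpectrum (𝓞 K))
    (x : galoisCohomology (κ.twistModP ρ hM J) 1) (k : ℕ) :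
    galoisCohomology.localization (κ.twistModP ρ hM J) (Sum.inr v) 1 ((κ.shiftH1 ρ hM J)^[k] x) =
      (galoisCohomology.map ((κ.twistModPShift ρ hM J).restrictField (v.adicCompletion K)) 1)^[k]
        (galoisCohomology.localization (κ.twistModP ρ hM J) (Sum.inr v) 1 x) :=
  localization_iterate_map (κ.twistModPShift ρ hM J) (Sum.inr v) x k

omit [Finite M] in
/-- **The seam to the uniform local exponent (G1-LOCAL)**: if `T_v^ε` kills `H¹(K_v, 𝒯_J|_v)` at the
finite place `v`, then `loc_v (T^ε ψ) = 0` for every global `ψ ∈ H¹(K, 𝒯_J)` — the hypothesis `hS` of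
`localTerm_twistDualMap_eq_zero_of_unramified_outside` for `y = T^ε ψ`. MU-TRANSFER-PROOF (F6)/STEP 1:
«`T^ε · loc_v y = 0`». [cite: MilneADT2006, Ch. I, Thm. 4.10(b)] -/
theorem localization_iterate_shiftH1_eq_zero_of_forall (v : HeightOneSpectrum (𝓞 K)) (ε : ℕ)
    (hT : ∀ c : galoisCohomology (GaloisRep.toLocal v (κ.twistModP ρ hM J)) 1,
      (galoisCohomology.map ((κ.twistModPShift ρ hM J).restrictField (v.adicCompletion K)) 1)^[ε] c = 0)
    (ψ : galoisCohomology (κ.twistModP ρ hM J) 1) :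
    galoisCohomology.localization (κ.twistModP ρ hM J) (Sum.inr v) 1 ((κ.shiftH1 ρ hM J)^[ε] ψ) = 0 := by
  rw [localization_iterate_shiftH1]
  exact hT _

/-! ### §2 STEP 4 in the Selmer side's currency: local exponent on `S`, unramified off `S ∪ {q}` -/

variable {e : M →+ M' →+ MuCarrier K p}
  (he : ∀ (g : absoluteGaloisGroup K) (m : M) (m' : M'), e (ρ g m) (ρ' g m') = mu K p g (e m m'))

/-- **MU-TRANSFER-PROOF §5 STEP 4, all coefficients, in the currency of the other hands.** `p` odd;
`inv` with the Poitou–Tate vanishing; `S` a finite set of finite places containing every `v ∣ p` and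
every ramified place `≠ q` of `ρ` (`hSp`, `hur`); `x ∈ H¹(K, 𝒯_J(ρ, κ))` with unramified localisations
off `S ∪ {q}` (the Kolyvagin class `κ_q` of G3); `ψ ∈ H¹(K, 𝒯_J(ρ′, κ⁻¹))` with unramified
localisations off `S ∪ {q}` (the Selmer-side class of G1); and the UNIFORM LOCAL EXPONENT `ε`:
`T_v^ε · H¹(K_v, 𝒯_J(ρ′, κ⁻¹)|_v) = 0` for `v ∈ S` (G1-LOCAL). Then for EVERY `k` the local term at `q` of
`(T^k x, (twistDualMap)_* (T^ε ψ))` vanishes: **every member of the coefficient family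
`Φ(κ_q, T^ε ψ)` of MU-TRANSFER-PROOF (F7) is zero.** [cite: MilneADT2006, Ch. I, Thm. 4.10(b)] -/
theorem localTerm_iterate_shiftH1_eq_zero_of_localExponent (hp : p ≠ 2)
    {inv : LocalInvariants K p} (hPT : inv.SumLocalTermEqZero)
    (S : Finset (HeightOneSpectrum (𝓞 K))) (q : HeightOneSpectrum (𝓞 K))
    (hSp : ∀ v ∉ S, v ≠ q → ((p : ℕ) : 𝓞 K) ∉ v.asIdeal)
    (hur : ∀ v ∉ S, v ≠ q → GaloisRep.IsUnramifiedAt v ρ)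
    (x : galoisCohomology (κ.twistModP ρ hM J) 1)
    (ψ : galoisCohomology (κ.invTwist.twistModP ρ' hM' J) 1)
    (hx : ∀ v ∉ S, v ≠ q → galoisCohomology.localization (κ.twistModP ρ hM J) (Sum.inr v) 1 x ∈
      DiscreteGaloisModule.unramifiedSubgroup (GaloisRep.toLocal v (κ.twistModP ρ hM J)) 1)
    (hψ : ∀ v ∉ S, v ≠ q →
      galoisCohomology.localization (κ.invTwist.twistModP ρ' hM' J) (Sum.inr v) 1 ψ ∈
        DiscreteGaloisModule.unramifiedSubgroup (GaloisRep.toLocal v (κ.invTwist.twistModP ρ' hM' J)) 1)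
    (ε : ℕ)
    (hT : ∀ v ∈ S, ∀ c : galoisCohomology (GaloisRep.toLocal v (κ.invTwist.twistModP ρ' hM' J)) 1,
      (galoisCohomology.map ((κ.invTwist.twistModPShift ρ' hM' J).restrictField (v.adicCompletion K))
        1)^[ε] c = 0)
    (k : ℕ) :
    inv.localTerm (κ.twistModP ρ hM J) (Sum.inr q) ((κ.shiftH1 ρ hM J)^[k] x)
      (galoisCohomology.map (κ.twistDualMap ρ ρ' p hM hM' J he) 1
        ((κ.invTwist.shiftH1 ρ' hM' J)^[ε] ψ)) = 0 :=
  localTerm_iterate_shiftH1_twistDualMap_eq_zero_of_unramified_outside κ ρ ρ' hM hM' J he hp hPT S q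
    hSp hur x _ hx
    (fun v hvS hvq =>
      iterate_shiftH1_localization_mem_unramifiedSubgroup κ.invTwist ρ' hM' J v (hψ v hvS hvq) ε)
    (fun v hvS => localization_iterate_shiftH1_eq_zero_of_forall κ.invTwist ρ' hM' J v ε (hT v hvS) ψ) k

/-! ### §3 Local forms of the term at `q` (the currency of the `q`-term identification) -/

omit [NumberField K] in
/-- **The local term at `q` on local classes**: `⟨x_q, ((twistDualMap)_* y)_q⟩_q = inv_q(loc_q x ∪ (twistDualMap|_{Γ_{K_q}})_* (loc_q y))`
for the tree's `localTatePairingZMod` (evaluation cup product on `H¹(K_q, 𝒯_J) × H¹(K_q, 𝒯_J^D)`).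
[cite: MilneADT2006, Ch. I, Cor. 2.3] -/
theorem localTerm_twistDualMap_eq_localTatePairingZMod [NumberField K] (inv : LocalInvariants K p)
    (v : Place K) (x : galoisCohomology (κ.twistModP ρ hM J) 1)
    (y : galoisCohomology (κ.invTwist.twistModP ρ' hM' J) 1) :
    inv.localTerm (κ.twistModP ρ hM J) v x (galoisCohomology.map (κ.twistDualMap ρ ρ' p hM hM' J he) 1 y) =
      DiscreteGaloisModule.localTatePairingZMod (κ.twistModP ρ hM J) p v (inv v)
        (galoisCohomology.localization (κ.twistModP ρ hM J) v 1 x)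
        (galoisCohomology.map ((κ.twistDualMap ρ ρ' p hM hM' J he).restrictField (Place.Completion v)) 1
          (galoisCohomology.localization (κ.invTwist.twistModP ρ' hM' J) v 1 y)) := by
  rw [LocalInvariants.localTerm_apply, DiscreteGaloisModule.localTatePairingZMod_apply, localization_map_eq]

variable [LocallyCompactSpace (absoluteGaloisGroup K)]

omit [Finite M] in
/-- **`loc_q(x ∪ y) = loc_q x ∪ loc_q y`** for k6-ty's `twistContPairing` and its RESTRICTION to
`Γ_{K_v}` (tree `ContPairing.cupProduct_res`; definitional, as in `PoitouTate.localization_cupProduct`).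
[cite: NeukirchSchmidtWingberg2008, I §4 (1.4.2)] -/
theorem localization_cupProduct_twistContPairing (v : Place K)
    [LocallyCompactSpace (absoluteGaloisGroup (Place.Completion v))]
    (x : galoisCohomology (κ.twistModP ρ hM J) 1) (y : galoisCohomology (κ.invTwist.twistModP ρ' hM' J) 1) :
    galoisCohomology.localization (mu K p) v 2 ((κ.twistContPairing ρ ρ' (mu K p) hM hM' J he).cupProduct x y) =
      ((κ.twistContPairing ρ ρ' (mu K p) hM hM' J he).restrict
          (absGaloisRestrict K (Place.Completion v))).cupProduct
        (galoisCohomology.localization (κ.twistModP ρ hM J) v 1 x)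
        (galoisCohomology.localization (κ.invTwist.twistModP ρ' hM' J) v 1 y) :=
  ContPairing.cupProduct_res (κ.twistContPairing ρ ρ' (mu K p) hM hM' J he)
    (absGaloisRestrict K (Place.Completion v)) x y

/-- **STEP 4 read on LOCAL classes at `q`** (the currency of the `q`-term identification, Lemma 1 (iii)):
under the hypotheses of `localTerm_iterate_shiftH1_eq_zero_of_localExponent`,
**`inv_q(T_q^k (loc_q x) ∪ loc_q (T^ε ψ)) = 0` for every `k`**, the cup product being that of the
pairing `twistContPairing` RESTRICTED to `Γ_{K_q}` and `T_q = H¹(twistModPShift|_{Γ_{K_q}})`.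
[cite: MilneADT2006, Ch. I, Thm. 4.10(b)] -/
theorem inv_cupProduct_restrict_iterate_localShift_eq_zero_of_localExponent (hp : p ≠ 2)
    {inv : LocalInvariants K p} (hPT : inv.SumLocalTermEqZero)
    (S : Finset (HeightOneSpectrum (𝓞 K))) (q : HeightOneSpectrum (𝓞 K))
    [LocallyCompactSpace (absoluteGaloisGroup (Place.Completion (Sum.inr q : Place K)))]
    (hSp : ∀ v ∉ S, v ≠ q → ((p : ℕ) : 𝓞 K) ∉ v.asIdeal)
    (hur : ∀ v ∉ S, v ≠ q → GaloisRep.IsUnramifiedAt v ρ)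
    (x : galoisCohomology (κ.twistModP ρ hM J) 1)
    (ψ : galoisCohomology (κ.invTwist.twistModP ρ' hM' J) 1)
    (hx : ∀ v ∉ S, v ≠ q → galoisCohomology.localization (κ.twistModP ρ hM J) (Sum.inr v) 1 x ∈
      DiscreteGaloisModule.unramifiedSubgroup (GaloisRep.toLocal v (κ.twistModP ρ hM J)) 1)
    (hψ : ∀ v ∉ S, v ≠ q →
      galoisCohomology.localization (κ.invTwist.twistModP ρ' hM' J) (Sum.inr v) 1 ψ ∈
        DiscreteGaloisModule.unramifiedSubgroup (GaloisRep.toLocal v (κ.invTwist.twistModP ρ' hM' J)) 1)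
    (ε : ℕ)
    (hT : ∀ v ∈ S, ∀ c : galoisCohomology (GaloisRep.toLocal v (κ.invTwist.twistModP ρ' hM' J)) 1,
      (galoisCohomology.map ((κ.invTwist.twistModPShift ρ' hM' J).restrictField (v.adicCompletion K))
        1)^[ε] c = 0)
    (k : ℕ) :
    inv (Sum.inr q)
      (((κ.twistContPairing ρ ρ' (mu K p) hM hM' J he).restrict
          (absGaloisRestrict K (Place.Completion (Sum.inr q : Place K)))).cupProduct
        ((galoisCohomology.map ((κ.twistModPShift ρ hM J).restrictField (q.adicCompletion K)) 1)^[k]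
          (galoisCohomology.localization (κ.twistModP ρ hM J) (Sum.inr q) 1 x))
        (galoisCohomology.localization (κ.invTwist.twistModP ρ' hM' J) (Sum.inr q) 1
          ((κ.invTwist.shiftH1 ρ' hM' J)^[ε] ψ))) = 0 := by
  rw [← localization_iterate_shiftH1, ← localization_cupProduct_twistContPairing]
  exact inv_localization_cupProduct_twistContPairing_iterate_shiftH1_eq_zero κ ρ ρ' hM hM' J he hp hPT S q
    hSp hur x _ hx
    (fun v hvS hvq =>
      iterate_shiftH1_localization_mem_unramifiedSubgroup κ.invTwist ρ' hM' J v (hψ v hvS hvq) ε)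
    (fun v hvS => localization_iterate_shiftH1_eq_zero_of_forall κ.invTwist ρ' hM' J v ε (hT v hvS) ψ) k

/-! ### §4 (appended) The PER-CLASS local annihilation `T_v^ε · loc_v ψ = 0` on `S`

At the places `v ∈ S ∖ {v ∣ p}` the whole `H¹(K_v, 𝒯_J)` is killed by a uniform power of `T` (G1-LOCAL),
but at `v ∣ p` it is not (its order grows with `J`): there STEP 1 gives the annihilation only for the
Selmer-side class itself (MU-TRANSFER-PROOF (F6)/§5 STEP 1: `loc_v y ∈ δ_v(H⁰(ℚ_v, 𝒯^∨)/T^J)` is killed by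
`T^ε`). The forms below therefore take the hypothesis PER CLASS: `T_v^ε (loc_v ψ) = 0` for `v ∈ S`. -/

omit [LocallyCompactSpace (absoluteGaloisGroup K)] in
/-- **MU-TRANSFER-PROOF §5 STEP 4, all coefficients, with the per-class annihilation on `S`.** As
`localTerm_iterate_shiftH1_eq_zero_of_localExponent`, but the places `v ∈ S` are discharged by
`T_v^ε (loc_v ψ) = 0` for the class `ψ` only (`hψS`) — the shape STEP 1 delivers at `v ∣ p`. Then for
EVERY `k` the local term at `q` of `(T^k x, (twistDualMap)_* (T^ε ψ))` vanishes.
[cite: MilneADT2006, Ch. I, Thm. 4.10(b)] -/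
theorem localTerm_iterate_shiftH1_eq_zero_of_localAnnihilator (hp : p ≠ 2)
    {inv : LocalInvariants K p} (hPT : inv.SumLocalTermEqZero)
    (S : Finset (HeightOneSpectrum (𝓞 K))) (q : HeightOneSpectrum (𝓞 K))
    (hSp : ∀ v ∉ S, v ≠ q → ((p : ℕ) : 𝓞 K) ∉ v.asIdeal)
    (hur : ∀ v ∉ S, v ≠ q → GaloisRep.IsUnramifiedAt v ρ)
    (x : galoisCohomology (κ.twistModP ρ hM J) 1)
    (ψ : galoisCohomology (κ.invTwist.twistModP ρ' hM' J) 1)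
    (hx : ∀ v ∉ S, v ≠ q → galoisCohomology.localization (κ.twistModP ρ hM J) (Sum.inr v) 1 x ∈
      DiscreteGaloisModule.unramifiedSubgroup (GaloisRep.toLocal v (κ.twistModP ρ hM J)) 1)
    (hψ : ∀ v ∉ S, v ≠ q →
      galoisCohomology.localization (κ.invTwist.twistModP ρ' hM' J) (Sum.inr v) 1 ψ ∈
        DiscreteGaloisModule.unramifiedSubgroup (GaloisRep.toLocal v (κ.invTwist.twistModP ρ' hM' J)) 1)
    (ε : ℕ)
    (hψS : ∀ v ∈ S,
      (galoisCohomology.map ((κ.invTwist.twistModPShift ρ' hM' J).restrictField (v.adicCompletion K))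
        1)^[ε] (galoisCohomology.localization (κ.invTwist.twistModP ρ' hM' J) (Sum.inr v) 1 ψ) = 0)
    (k : ℕ) :
    inv.localTerm (κ.twistModP ρ hM J) (Sum.inr q) ((κ.shiftH1 ρ hM J)^[k] x)
      (galoisCohomology.map (κ.twistDualMap ρ ρ' p hM hM' J he) 1
        ((κ.invTwist.shiftH1 ρ' hM' J)^[ε] ψ)) = 0 :=
  localTerm_iterate_shiftH1_twistDualMap_eq_zero_of_unramified_outside κ ρ ρ' hM hM' J he hp hPT S q
    hSp hur x _ hx
    (fun v hvS hvq =>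
      iterate_shiftH1_localization_mem_unramifiedSubgroup κ.invTwist ρ' hM' J v (hψ v hvS hvq) ε)
    (fun v hvS => by rw [localization_iterate_shiftH1]; exact hψS v hvS) k

/-- **STEP 4 on LOCAL classes at `q`, per-class annihilation on `S`**: under the hypotheses of
`localTerm_iterate_shiftH1_eq_zero_of_localAnnihilator`, `inv_q(T_q^k (loc_q x) ∪ loc_q (T^ε ψ)) = 0` for
every `k` (restricted `twistContPairing`). [cite: MilneADT2006, Ch. I, Thm. 4.10(b)] -/
theorem inv_cupProduct_restrict_iterate_localShift_eq_zero_of_localAnnihilator (hp : p ≠ 2)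
    {inv : LocalInvariants K p} (hPT : inv.SumLocalTermEqZero)
    (S : Finset (HeightOneSpectrum (𝓞 K))) (q : HeightOneSpectrum (𝓞 K))
    [LocallyCompactSpace (absoluteGaloisGroup (Place.Completion (Sum.inr q : Place K)))]
    (hSp : ∀ v ∉ S, v ≠ q → ((p : ℕ) : 𝓞 K) ∉ v.asIdeal)
    (hur : ∀ v ∉ S, v ≠ q → GaloisRep.IsUnramifiedAt v ρ)
    (x : galoisCohomology (κ.twistModP ρ hM J) 1)
    (ψ : galoisCohomology (κ.invTwist.twistModP ρ' hM' J) 1)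
    (hx : ∀ v ∉ S, v ≠ q → galoisCohomology.localization (κ.twistModP ρ hM J) (Sum.inr v) 1 x ∈
      DiscreteGaloisModule.unramifiedSubgroup (GaloisRep.toLocal v (κ.twistModP ρ hM J)) 1)
    (hψ : ∀ v ∉ S, v ≠ q →
      galoisCohomology.localization (κ.invTwist.twistModP ρ' hM' J) (Sum.inr v) 1 ψ ∈
        DiscreteGaloisModule.unramifiedSubgroup (GaloisRep.toLocal v (κ.invTwist.twistModP ρ' hM' J)) 1)
    (ε : ℕ)
    (hψS : ∀ v ∈ S,
      (galoisCohomology.map ((κ.invTwist.twistModPShift ρ' hM' J).restrictField (v.adicCompletion K))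
        1)^[ε] (galoisCohomology.localization (κ.invTwist.twistModP ρ' hM' J) (Sum.inr v) 1 ψ) = 0)
    (k : ℕ) :
    inv (Sum.inr q)
      (((κ.twistContPairing ρ ρ' (mu K p) hM hM' J he).restrict
          (absGaloisRestrict K (Place.Completion (Sum.inr q : Place K)))).cupProduct
        ((galoisCohomology.map ((κ.twistModPShift ρ hM J).restrictField (q.adicCompletion K)) 1)^[k]
          (galoisCohomology.localization (κ.twistModP ρ hM J) (Sum.inr q) 1 x))
        (galoisCohomology.localization (κ.invTwist.twistModP ρ' hM' J) (Sum.inr q) 1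
          ((κ.invTwist.shiftH1 ρ' hM' J)^[ε] ψ))) = 0 := by
  rw [← localization_iterate_shiftH1, ← localization_cupProduct_twistContPairing]
  exact inv_localization_cupProduct_twistContPairing_iterate_shiftH1_eq_zero κ ρ ρ' hM hM' J he hp hPT S q
    hSp hur x _ hx
    (fun v hvS hvq =>
      iterate_shiftH1_localization_mem_unramifiedSubgroup κ.invTwist ρ' hM' J v (hψ v hvS hvq) ε)
    (fun v hvS => by rw [localization_iterate_shiftH1]; exact hψS v hvS) k

end Twist

end Summit.BirchSwinnertonDyer.BirchSwinnertonDyer.Rank1Residual.StepFour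

end
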